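import Summits.Ventures.Crystal3D.Theorems.StickyWulffConstantCoaxialWallLawTailResidueDefs
import Summits.Ventures.Crystal3D.Theorems.StickyWulffConstantCoaxialWallLawDustDeletionResidue
import HarnessLib

/-!
# The off-module tails and lane F's crux FROM THE NAMED FINITE FACT `TailResidueCert` and the type-soundness targets
# (crux `CoaxialWallLaw`, stmt-Ventures-19481, line `WallLedgerF`; cf-p1 DECISION (xci) closing shape)

HONEST FRAMING. Venture `Summits/Ventures/Crystal3D` (cell `crystal3d-full`), helper `--supports` the crux `CoaxialWallLaw`
(stmt-Ventures-19481, `route-Ventures-StickyWulffConstant`), REGISTERED line `WallLedgerF` (planner cf-p1).  Rung credit; F-C1 not moved;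
CONDITIONAL on named facts (no certificate and no soundness lemma is proved here).  cf-p1 (xci)(1): «closing theorems
`endRow{Trans,Twin,Joint}TailA_twoSqrtSix_cx : TailResidueCert (2*Real.sqrt 6) → EndRow…TailA v2 (2√6) 𝒰_cx`» — here with the T4 target
`TailTypeSoundness…` (`…TailResidueDefs`) as the second named hypothesis until it is a landed lemma:

* `endRowTransTailA_of_cert`, `endRowTwinTailA_of_cert`, `endRowJointTailA_of_cert` — any line `s`: flat certificate(s) at `s` +
  `TailResidueCert s` + type soundness ⇒ the tail at `s` (via `endRow…TailA_of_residue`, `…DustDeletionResidue`);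
* **`endRowTransTailA_twoSqrtSix_cx`**, **`endRowTwinTailA_twoSqrtSix_cx`**, **`endRowJointTailA_twoSqrtSix_cx`** — the instances of
  record (translation certificate at `9/2` by monotonicity, joint certificate at `2√6`);
* **`coaxialWallLaw_of_certificates : P5Exhaustion → EndRowOnSiteFlatA v2 (9/2) 𝒰_cx → TailResidueCert (2√6) →
  TailTypeSoundnessTrans → TailTypeSoundnessTwin → CoaxialWallLaw`** — LANE F'S CRUX BY NAME from E1, the bnb-ucx certificate,
  the T3 certificate and the two T4 soundness lemmas (composition with `coaxialWallLaw_of_onSiteFlatA_v2A_twoSqrtSix_cx`);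
* `endRowJointA_of_certificates` — T-F2's joint row likewise (with 'jointrow' and `TailTypeSoundnessJoint`).
WHAT THIS IS NOT: no certificate, no soundness proof; F-C1 not moved.
-/

noncomputable section

namespace Summit.Ventures.Crystal3D.Theorems

open Summit.Ventures.Crystal3D Finset TailResidue
open scoped InnerProductSpace

/-! ### Any line -/

/-- **Translation tail from the certificates and type soundness** (line `s`). -/
theorem endRowTransTailA_of_cert {s : ℝ} (hon : EndRowOnSiteFlatA WordVersion.v2 s coaxialModuleUniverse)
    (hcert : TailResidueCert s) (hsound : TailTypeSoundnessTrans) : EndRowTransTailA WordVersion.v2 s coaxialModuleUniverse :=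
  endRowTransTailA_of_residue hon fun L X hX z hz hdeg hoff => by
    rcases hsound L X hX z hz hdeg hoff with h | ⟨τ, hwf, hre, ε, n, hn, hle⟩
    · exact Or.inl h
    · exact Or.inr (hle.trans ((hcert τ hwf hre).1 ε n hn))

/-- **Twin tail from the certificates and type soundness** (line `s`). -/
theorem endRowTwinTailA_of_cert {s : ℝ} (hon : EndRowOnSiteFlatA WordVersion.v2 s coaxialModuleUniverse)
    (hcert : TailResidueCert s) (hsound : TailTypeSoundnessTwin) : EndRowTwinTailA WordVersion.v2 s coaxialModuleUniverse :=
  endRowTwinTailA_of_residue hon fun L X hX z hz hdeg hoff => by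
    rcases hsound L X hX z hz hdeg hoff with h | ⟨τ, hwf, hre, hrow⟩
    · exact Or.inl h
    · rcases hrow with ⟨ε, n, hn, hle⟩ | ⟨ε, h, hh, hle⟩
      · exact Or.inr (hle.trans ((hcert τ hwf hre).1 ε n hn))
      · exact Or.inr (hle.trans ((hcert τ hwf hre).2.1 ε h hh))

/-- **Joint tail from the certificates and type soundness** (line `s`). -/
theorem endRowJointTailA_of_cert {s : ℝ} (honT : EndRowOnSiteFlatA WordVersion.v2 s coaxialModuleUniverse)
    (honJ : EndRowOnSiteJointFlatA WordVersion.v2 s coaxialModuleUniverse) (hcert : TailResidueCert s)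
    (hsound : TailTypeSoundnessJoint) : EndRowJointTailA WordVersion.v2 s coaxialModuleUniverse :=
  endRowJointTailA_of_residue honT honJ fun L X hX z hz hdeg hoff => by
    rcases hsound L X hX z hz hdeg hoff with h | ⟨τ, hwf, hre, hrow⟩
    · exact Or.inl h
    · rcases hrow with ⟨ε, n, hn, hle⟩ | hle
      · exact Or.inr (hle.trans ((hcert τ hwf hre).1 ε n hn))
      · exact Or.inr (hle.trans (hcert τ hwf hre).2.2)

/-! ### The instances of record at `2√6` -/

/-- **The translation tail of record**: `TailResidueCert (2√6)` + soundness + the bnb-ucx certificate at `9/2`. -/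
theorem endRowTransTailA_twoSqrtSix_cx (hon : EndRowOnSiteFlatA WordVersion.v2 (9 / 2) coaxialModuleUniverse)
    (hcert : TailResidueCert (2 * Real.sqrt 6)) (hsound : TailTypeSoundnessTrans) :
    EndRowTransTailA WordVersion.v2 (2 * Real.sqrt 6) coaxialModuleUniverse :=
  endRowTransTailA_of_cert (endRowOnSiteFlatA_mono_const nine_halves_le_two_sqrt_six hon) hcert hsound

/-- **The twin tail of record.** -/
theorem endRowTwinTailA_twoSqrtSix_cx (hon : EndRowOnSiteFlatA WordVersion.v2 (9 / 2) coaxialModuleUniverse)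
    (hcert : TailResidueCert (2 * Real.sqrt 6)) (hsound : TailTypeSoundnessTwin) :
    EndRowTwinTailA WordVersion.v2 (2 * Real.sqrt 6) coaxialModuleUniverse :=
  endRowTwinTailA_of_cert (endRowOnSiteFlatA_mono_const nine_halves_le_two_sqrt_six hon) hcert hsound

/-- **The joint tail of record** (joint certificate 'jointrow' at `2√6`). -/
theorem endRowJointTailA_twoSqrtSix_cx (honT : EndRowOnSiteFlatA WordVersion.v2 (9 / 2) coaxialModuleUniverse)
    (honJ : EndRowOnSiteJointFlatA WordVersion.v2 (2 * Real.sqrt 6) coaxialModuleUniverse)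
    (hcert : TailResidueCert (2 * Real.sqrt 6)) (hsound : TailTypeSoundnessJoint) :
    EndRowJointTailA WordVersion.v2 (2 * Real.sqrt 6) coaxialModuleUniverse :=
  endRowJointTailA_of_cert (endRowOnSiteFlatA_mono_const nine_halves_le_two_sqrt_six honT) honJ hcert hsound

/-! ### The crux and the joint row by name -/

/-- **LANE F'S CRUX BY NAME FROM THE CERTIFICATES**: `P5Exhaustion` (E1), the 𝒰_cx flat certificate at `9/2` (bnb-ucx), the tail
residue certificate at `2√6` (T3) and the two type-soundness lemmas (T4) give `CoaxialWallLaw`. -/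
theorem coaxialWallLaw_of_certificates (hE1 : P5Exhaustion)
    (hon : EndRowOnSiteFlatA WordVersion.v2 (9 / 2) coaxialModuleUniverse) (hcert : TailResidueCert (2 * Real.sqrt 6))
    (hsT : TailTypeSoundnessTrans) (hsW : TailTypeSoundnessTwin) :
    Summit.Ventures.Crystal3D.Theses.StickyWulffConstant.CoaxialWallLaw :=
  coaxialWallLaw_of_onSiteFlatA_v2A_twoSqrtSix_cx hE1 hon (endRowTwinTailA_twoSqrtSix_cx hon hcert hsW)
    (endRowTransTailA_twoSqrtSix_cx hon hcert hsT)

/-- **T-F2's joint row by name from the certificates**: bnb-ucx at `9/2`, 'jointrow' at `2√6`, the residue certificate and the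
joint type soundness give `EndRowJointA v2 (2√6)`. -/
theorem endRowJointA_of_certificates (honT : EndRowOnSiteFlatA WordVersion.v2 (9 / 2) coaxialModuleUniverse)
    (honJ : EndRowOnSiteJointFlatA WordVersion.v2 (2 * Real.sqrt 6) coaxialModuleUniverse)
    (hcert : TailResidueCert (2 * Real.sqrt 6)) (hsJ : TailTypeSoundnessJoint) :
    EndRowJointA WordVersion.v2 (2 * Real.sqrt 6) :=
  endRowJointA_v2_twoSqrtSix_cx honT honJ (endRowJointTailA_twoSqrtSix_cx honT honJ hcert hsJ)

end Summit.Ventures.Crystal3D.Theorems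

end
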